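import Summits.BirchSwinnertonDyer.BirchSwinnertonDyer.Theorems.KolyvaginDepthDoorDepthTableKuriharaDecisivePrime
import Summits.BirchSwinnertonDyer.BirchSwinnertonDyer.Theorems.KolyvaginDepthDoorDepthTableKuriharaSocket997c1Neg23
import Summits.BirchSwinnertonDyer.Rank1Residual.Supersingular.CountPointsFast
import HarnessLib

/-!
# Route `KolyvaginDepthDoor`, crux `KolyvaginDepthSupplyKN` (stmt-BirchSwinnertonDyer-22820) —
# DEPTH TABLE v20, ROW `997c1` @ `(7, d_K = -23)`: THE DECISIVE PRIME `ℓ★ = 239` of the twist model `T₀ = [0, -1, 1, -12872, -557532]`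
# (kernel: `32 • P̄ ≠ O` in `T̃₀(𝔽_239)` for the tree's twist point `P = (116922/289, 38145975/4913)`, `#T̃₀(𝔽_239) = 224 = 7·32`) — the bit FORCES a unit
# at `239`, and a unit at `239` CLOSES the crux at `997c1`

Helper file of the lead prover of line `levelone` (kdd-p1 g24; `--supports stmt-BirchSwinnertonDyer-22820
--as helper`); it closes nothing and BSD is NOT proved by it. Same template as `…KuriharaDecisive794a1` (Selmer-bound form,
no kernel 2-descent for `997c1`) with the rational-point bridge of `…KuriharaDecisive681c1`.

The row of record `997c1` @ `(7, -67)` has no decisive prime (no rational point known on its twist model). At the alternative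
Heegner field `-23` (socket `…KuriharaSocket997c1Neg23`, this generation) the v12 table's kernel twist point
(`C997c1.one_le_rank_twist_neg23`, g16, on the `u = 1/2` model) transports to `P = (116922/289, 38145975/4913)` on the minimal model `T₀`
(`x = X/4 + 8`, `y = Y/8 − 1/2`; denominators prime to `239`); at the least cyclic Kolyvagin prime `239` of `(T₀, 7)`
(`#T̃₀(𝔽_239) = 224`, `a_239(T₀) = 16 ≡ 2 (mod 7)`) its reduction `P̄ = (197, 37)` has `32 • P̄ = (202, 230) ≠ O` (5-step chain,
`decide`), so `P ∉ 7·T₀(ℚ_239)` (`localNondivisible_of_chainB_rat`). HENCE, with Sakamoto 2022 L4.4 + L4.6 (1) BY NAME (`hSak3`):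

* `twistKuriharaClaim_239_of_natCard_selmerGroup_le` — `#Sel_7(E^{(-23)}) ≤ 7 ⟹` unit `δ̃_239(T₀)` for every admissible datum
  (the claim of a future tree record `cert_<T₀>` @ `(7, 239)`).
* `twistKuriharaClaim_239_of_bit` — the depth-table BIT at `(7, -23)` ⟹ unit at `239` (the bit gives `rank E = 2 ∧ Ш(E)[7] = 0 ∧
  #Sel_7(E^{(-23)}) ≤ 7` by `exactRowZhang_7_neg23`): a computed ZERO at `239` refutes the bit at `(7, ℚ(√-23))` modulo print.
* `cruxBody_of_unit_239` — a unit at `239` ⟹ the clause of `KolyvaginDepthSupplyKN` at `997c1` VERBATIM (socket with `m = 239`).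
  So ONE residue `δ̃_239(T₀) mod 7` decides the crux AT `997c1` modulo print (two-way up to the rank conjunct: without a kernel
  `rank 997c1 = 2` the converse lands on the clause, not on the bit). Further cyclic Kolyvagin primes of `(T₀, 7)`: `617, 673, 757, 883, 911 (★ for P; 701 is ∘)`.

CONDITIONAL on the named facts displayed and the record claims; per curve; nothing class-wide; BSD is NOT proved by any of this.

References: [Sakamoto2022pSelmer] Lemma 4.4, Lemma 4.6 (1); [Kim2022StructureSelmer] Thm. 1.11, §1.2.2; [WZhang2014] Lemma 8.4 (1),
Thm. 9.1; [GrossLMS1991] Prop. 3.7 (2); [Kurihara2014] §5.3; [SilvermanAEC2009] III.2.3, VII.2.1, VII.3.1, X.4.2, X.5 Cor. 5.4;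
[CremonaAlgorithms1997] Table 1 (997c1).
-/

set_option linter.dupNamespace false

noncomputable section

open scoped Classical NumberField

namespace Summit.BirchSwinnertonDyer.BirchSwinnertonDyer.Theorems.KolyvaginDepthDoor

open Literature.NumberTheory.EllipticCurves Literature.NumberTheory.EllipticCurves.ModularForms
  WeierstrassCurve NumberField IsDedekindDomain
open Summit.BirchSwinnertonDyer.BirchSwinnertonDyer.Theorems
open Summit.BirchSwinnertonDyer.BirchSwinnertonDyer.Rank2Observatory
open Summit.BirchSwinnertonDyer.BirchSwinnertonDyer.Rank1Residual (IntModel.frobeniusTrace_eq)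
open Summit.BirchSwinnertonDyer.Rank1Residual.Supersingular (natCard_point_eq_of_countPoints countPoints_eq_of_fast)
open Summit.BirchSwinnertonDyer.Rank1Residual.Additive (card_torsion_le_of_intModel_of_card
  isKolyvaginPrime_of_intModel_of_card)

namespace C997c1

/-! ## §1 Kernel: `239` is a cyclic Kolyvagin prime of `(T₀, 7)` at which the tree's twist point is locally `7`-indivisible -/

/-- `#T̃₀(𝔽_239) = 224 = 7·32` for `T₀ = [0, -1, 1, -12872, -557532]` (`239 ≡ 1 (mod 7)`, `a_239(T₀) = 16 ≡ 2 (mod 7)`, `7² ∤ 224`),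
kernel-decided (`countPointsFast`). [cite: Kim2022StructureSelmer, §1.2.2 (PDF p. 5)] -/
theorem minTwist23_card_239 :
    Nat.card (((⟨0, -1, 1, -12872, -557532⟩ : WeierstrassCurve ℤ).map (Int.castRingHom (ZMod 239))).toAffine.Point) = 224 :=
  haveI : Fact (Nat.Prime 239) := ⟨by norm_num⟩
  natCard_point_eq_of_countPoints 0 (-1) 1 (-12872) (-557532) 239 (by norm_num) (by decide +kernel) (n := 224)
    (countPoints_eq_of_fast (by decide +kernel))

/-- **`239` is a CYCLIC KOLYVAGIN PRIME for `(T₀, 7)`** (`239 ∤ 7·N_{T₀}`, `239 ≡ 1`, `a_239(T₀) ≡ 2 (mod 7)`, `#T̃₀(𝔽_239)[7] ≤ 7`).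
[cite: Kim2022StructureSelmer, §1.2.2 (PDF p. 5)] -/
theorem minTwist23_isCyclicKolyvaginLevel_7_239 :
    haveI := minTwist23_isGloballyMinimal; haveI := Fact.mk (by norm_num : Nat.Prime 7);
    IsCyclicKolyvaginLevel ((⟨0, -1, 1, -12872, -557532⟩ : WeierstrassCurve ℤ).map (Int.castRingHom ℚ)) 7 239 := by
  haveI := minTwist23_isElliptic
  haveI := minTwist23_isGloballyMinimal
  haveI := Fact.mk (by norm_num : Nat.Prime 7)
  haveI : Fact (Nat.Prime 239) := ⟨by norm_num⟩
  have hℓ : Kato.IsKolyvaginPrime ((⟨0, -1, 1, -12872, -557532⟩ : WeierstrassCurve ℤ).map (Int.castRingHom ℚ)) 7 1 239 :=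
    isKolyvaginPrime_of_intModel_of_card minTwist23_intModel 7 1 239 (by norm_num) (by decide +kernel) (by decide)
      minTwist23_card_239 (by norm_num)
  refine ⟨⟨Nat.squarefree_iff_nodup_primeFactorsList (by norm_num) |>.mpr (by simp), fun ℓ hℓ' ↦ ?_⟩, fun ℓ hℓ' hdvd ↦ ?_⟩
  · rw [show (239 : ℕ).primeFactors = {239} from (Nat.Prime.primeFactors (by norm_num)), Finset.mem_singleton] at hℓ'
    exact hℓ' ▸ hℓ
  · obtain rfl := (Nat.prime_dvd_prime_iff_eq hℓ'.out (by norm_num)).mp hdvd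
    exact card_torsion_le_of_intModel_of_card minTwist23_intModel 7 239 minTwist23_card_239 (by norm_num)

/-- The rational point `P = (116922/289, 38145975/4913)` of `T₀ = [0, -1, 1, -12872, -557532]` (denominators powers of primes `≠ 239`; on the curve). [folklore] -/
theorem minTwist23_nonsingular_P :
    ((⟨0, -1, 1, -12872, -557532⟩ : WeierstrassCurve ℤ).map (Int.castRingHom ℚ)).toAffine.Nonsingular ((116922 : ℚ) / 289) ((38145975 : ℚ) / 4913) :=
  nonsingular_rat_of_eq_rat _ (by decide +kernel) (by norm_num)

/-- The double-and-add chain from `P̄` reaches the multiplier `32`. [folklore] -/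
theorem chain239_mult :
    chainMult 1 [(true, ((146 : ℤ) : ZMod 239), ((8 : ℤ) : ZMod 239)), (true, ((198 : ℤ) : ZMod 239), ((72 : ℤ) : ZMod 239)), (true, ((151 : ℤ) : ZMod 239), ((96 : ℤ) : ZMod 239)), (true, ((29 : ℤ) : ZMod 239), ((37 : ℤ) : ZMod 239)), (true, ((202 : ℤ) : ZMod 239), ((230 : ℤ) : ZMod 239))] = 32 := by
  decide

/-- The double-and-add chain from `P̄ = (197, 37)` to `32 • P̄ = (202, 230)` in `T̃₀(𝔽_239)` CHECKS (tangent / chord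
certificates, `decide`). [cite: SilvermanAEC2009, III.2.3] -/
theorem chain239_ok :
    chainB (⟨0, -1, 1, -12872, -557532⟩ : WeierstrassCurve ℤ) 239 (((197 : ℤ)) : ZMod 239) (((37 : ℤ)) : ZMod 239)
      ((((197 : ℤ)) : ZMod 239), (((37 : ℤ)) : ZMod 239))
      [(true, ((146 : ℤ) : ZMod 239), ((8 : ℤ) : ZMod 239)), (true, ((198 : ℤ) : ZMod 239), ((72 : ℤ) : ZMod 239)), (true, ((151 : ℤ) : ZMod 239), ((96 : ℤ) : ZMod 239)), (true, ((29 : ℤ) : ZMod 239), ((37 : ℤ) : ZMod 239)), (true, ((202 : ℤ) : ZMod 239), ((230 : ℤ) : ZMod 239))] = true := by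
  decide +kernel

/-- **KERNEL: `P = (116922/289, 38145975/4913)` is not divisible by `7` in `T₀(ℚ_239)`** — the chain certifies `32 • P̄ ≠ O` in
`T̃₀(𝔽_239)` for the reduction `P̄ = (197, 37)`, `7·32 = #T̃₀(𝔽_239)`, and `localNondivisible_of_chainB_rat`.
[cite: SilvermanAEC2009, III.2.3, VII.2 Prop. 2.1, VII.3 Prop. 3.1] -/
theorem minTwist23_localNondivisible_239 :
    haveI : Fact (Nat.Prime 239) := ⟨by norm_num⟩;
    ∀ Q : (((⟨0, -1, 1, -12872, -557532⟩ : WeierstrassCurve ℤ).map (Int.castRingHom ℚ)).baseChange ℚ_[239]).toAffine.Point,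
      7 • Q ≠ WeierstrassCurve.Affine.Point.map (W' := ((⟨0, -1, 1, -12872, -557532⟩ : WeierstrassCurve ℤ).map (Int.castRingHom ℚ)).toAffine)
        (S := ℚ) (Algebra.ofId ℚ ℚ_[239]) (.some ((116922 : ℚ) / 289) ((38145975 : ℚ) / 4913) minTwist23_nonsingular_P) := by
  haveI : Fact (Nat.Prime 239) := ⟨by norm_num⟩
  have hq : ¬ ((239 : ℕ) : ℤ) ∣ (⟨0, -1, 1, -12872, -557532⟩ : WeierstrassCurve ℤ).Δ := by decide +kernel
  have hx : ¬ (239 : ℕ) ∣ (((116922 : ℚ) / 289)).den := by decide +kernel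
  have hy : ¬ (239 : ℕ) ∣ (((38145975 : ℚ) / 4913)).den := by decide +kernel
  have hm : ((239 : ℕ) : ℤ) ∣ (((116922 : ℚ) / 289)).num - (197 : ℤ) * (((116922 : ℚ) / 289)).den := by decide +kernel
  have hm' : ((239 : ℕ) : ℤ) ∣ (((38145975 : ℚ) / 4913)).num - (37 : ℤ) * (((38145975 : ℚ) / 4913)).den := by decide +kernel
  have hpk : 7 * 32 = Nat.card (((⟨0, -1, 1, -12872, -557532⟩ : WeierstrassCurve ℤ).map (Int.castRingHom (ZMod 239))).toAffine.Point) := by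
    rw [minTwist23_card_239]
  exact localNondivisible_of_chainB_rat (⟨0, -1, 1, -12872, -557532⟩ : WeierstrassCurve ℤ) 239 hq minTwist23_nonsingular_P hx hy hm hm' hpk
    chain239_mult (by convert chain239_ok)


/-! ## §2 The decisive prime `239` -/

/-- **ROW `997c1` @ `(7, -23)`: THE DECISIVE PRIME `239`, Selmer-bound form.** For every imaginary quadratic `K` with `d_K = -23`,
granted `hSak3` (Sakamoto 2022 L4.4 + L4.6 (1) by name): IF `#Sel_7(E^{(d_K)}/ℚ) ≤ 7`, THEN every datum `D` of `T₀` at level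
`N_{T₀}` with `7 ∤ c_D` and the period transfer has a UNIT mod-`7` Kurihara number AT `239`. Contrapositive: a computed ZERO at `239`
certifies `#Sel_7(E^{(-23)}) > 7` modulo print. Side conditions all kernel. CONDITIONAL on `hSak3`; per curve; BSD is not proved
by it. [cite: Sakamoto2022pSelmer, Lemma 4.4, Lemma 4.6 (1)] [cite: SilvermanAEC2009, X.5 Cor. 5.4] [cite: CremonaAlgorithms1997, Table 1 (997c1)] -/
theorem twistKuriharaClaim_239_of_natCard_selmerGroup_le
    (hSak3 : Literature.NumberTheory.EllipticCurves.Sakamoto2022_kuriharaNumber_prime_ne_zero_of_localNondivisible)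
    (K : Type) [Field K] [NumberField K] (hD : NumberField.discr K = -23)
    (hle : haveI := isElliptic_c997c1; haveI := isGloballyMinimal_c997c1; haveI := Fact.mk (by norm_num : Nat.Prime 7);
      Nat.card ((((⟨0, -1, 1, -24, 54⟩ : WeierstrassCurve ℤ).map (Int.castRingHom ℚ)).quadraticTwist (NumberField.discr K : ℚ)).selmerGroup (7 : ℕ)) ≤ 7) :
    haveI := minTwist23_isElliptic; haveI := minTwist23_isGloballyMinimal;
    haveI : NeZero (((⟨0, -1, 1, -12872, -557532⟩ : WeierstrassCurve ℤ).map (Int.castRingHom ℚ)).conductorNorm ℤ) := neZero_conductorNorm_of_isElliptic _;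
    haveI := Fact.mk (by norm_num : Nat.Prime 7);
    ∀ (D : ModularParametrizationData ((⟨0, -1, 1, -12872, -557532⟩ : WeierstrassCurve ℤ).map (Int.castRingHom ℚ)) (((⟨0, -1, 1, -12872, -557532⟩ : WeierstrassCurve ℤ).map (Int.castRingHom ℚ)).conductorNorm ℤ)),
      ¬ ((7 : ℕ) : ℤ) ∣ D.maninConstant →
      (∃ u : ℚ, ‖(u : ℚ_[7])‖ = 1 ∧ ((⟨0, -1, 1, -12872, -557532⟩ : WeierstrassCurve ℤ).map (Int.castRingHom ℚ)).realPeriodRat = u * plusPeriod D.f) →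
      ∃ ψ : (q : ℕ) → (ZMod q)ˣ →* Multiplicative (ZMod 7),
        (∀ q ∈ (239 : ℕ).primeFactors, Function.Surjective (ψ q)) ∧ kuriharaNumber D.f 7 239 ψ ≠ 0 := by
  haveI := isElliptic_c997c1
  haveI := isGloballyMinimal_c997c1
  haveI iNZ : NeZero (((⟨0, -1, 1, -24, 54⟩ : WeierstrassCurve ℤ).map (Int.castRingHom ℚ)).conductorNorm ℤ) := neZero_conductorNorm_of_isElliptic _
  haveI := minTwist23_isElliptic
  haveI := minTwist23_isGloballyMinimal
  haveI iNZT : NeZero (((⟨0, -1, 1, -12872, -557532⟩ : WeierstrassCurve ℤ).map (Int.castRingHom ℚ)).conductorNorm ℤ) := neZero_conductorNorm_of_isElliptic _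
  haveI iP := Fact.mk (by norm_num : Nat.Prime 7)
  haveI : Fact (Nat.Prime 239) := ⟨by norm_num⟩
  have hsur : ((⟨0, -1, 1, -24, 54⟩ : WeierstrassCurve ℤ).map (Int.castRingHom ℚ)).HasSurjectiveModNGaloisRep ((7 : ℕ) : ℤ) := by
    simpa using hasSurjectiveModNGaloisRep_7
  have hC : (⟨1, (8 : ℚ), (0 : ℚ), -((1 : ℚ) / 2)⟩ : WeierstrassCurve.VariableChange ℚ) • ((⟨0, -1, 1, -12872, -557532⟩ : WeierstrassCurve ℤ).map (Int.castRingHom ℚ)) =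
      ((⟨0, -1, 1, -24, 54⟩ : WeierstrassCurve ℤ).map (Int.castRingHom ℚ)).quadraticTwist ((NumberField.discr K : ℤ) : ℚ) := by
    rw [hD]; push_cast; exact minTwist23_smul_eq
  have hpD : ¬ (((7 : ℕ) : ℤ) ∣ NumberField.discr K) := by rw [hD]; decide
  intro D hc hu
  exact twistKuriharaClaim_prime_of_natCard_selmerGroup_le hSak3 _ 7 (by norm_num) goodOrdinary_7.1 goodOrdinary_7.2 hsur
    (NumberField.discr_ne_zero K) hpD _ _ hC minTwist23_nonAnomalous_7 minTwist23_kodairaNeron_7 hle 239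
    minTwist23_isCyclicKolyvaginLevel_7_239 _ minTwist23_localNondivisible_239 D hc hu

/-- **ROW `997c1` @ `(7, -23)`: the BIT FORCES a unit at `239`.** For every imaginary quadratic `K` with `d_K = -23`, granted
(γ), W. Zhang L8.4 (1) and `hSak3` BY NAME: «some frame, some Kolyvagin PRIME `ℓ`, some datum of conductor `ℓ` with
`c_1(ℓ) ≠ 0`» ⟹ a unit `δ̃_239(T₀)` for every admissible datum — because the bit gives `#Sel_7(E^{(-23)}) ≤ 7` (with `rank E = 2`
and `Ш(E)[7] = 0`) by `exactRowZhang_7_neg23`. Contrapositive: ONE computed zero at `239` refutes the row's bit at `(7, ℚ(√-23))`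
modulo print. CONDITIONAL; per curve; BSD is not proved by it. [cite: Sakamoto2022pSelmer, Lemma 4.4, Lemma 4.6 (1)]
[cite: WZhang2014, Lemma 8.4 (1) (p. 236)] [cite: GrossLMS1991, Prop. 3.7 (2)] [cite: CremonaAlgorithms1997, Table 1 (997c1)] -/
theorem twistKuriharaClaim_239_of_bit
    (h372 : GrossLMS1991.prop37_2_frobeniusCongruence)
    (h84 : Literature.NumberTheory.EllipticCurves.WZhang2014_lemma84_exists_minimal_kolyvaginClass_one_selmerCard)
    (hSak3 : Literature.NumberTheory.EllipticCurves.Sakamoto2022_kuriharaNumber_prime_ne_zero_of_localNondivisible)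
    (K : Type) [Field K] [NumberField K] (hK : IsImaginaryQuadratic K) (hD : NumberField.discr K = -23)
    (hbit : haveI := isElliptic_c997c1; haveI := isGloballyMinimal_c997c1;
      haveI : NeZero (((⟨0, -1, 1, -24, 54⟩ : WeierstrassCurve ℤ).map (Int.castRingHom ℚ)).conductorNorm ℤ) := neZero_conductorNorm_of_isElliptic _;
      haveI := Fact.mk (by norm_num : Nat.Prime 7);
      (∃ (Dt : ModularParametrizationData ((⟨0, -1, 1, -24, 54⟩ : WeierstrassCurve ℤ).map (Int.castRingHom ℚ)) (((⟨0, -1, 1, -24, 54⟩ : WeierstrassCurve ℤ).map (Int.castRingHom ℚ)).conductorNorm ℤ)) (β : ℤ)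
      (ι : K →+* ℂ) (ℓ : ℕ) (d : KolyvaginHeegnerData Dt β ι ℓ),
      ℓ.Prime ∧ Zhang2014.IsKolyvaginPrime (((⟨0, -1, 1, -24, 54⟩ : WeierstrassCurve ℤ).map (Int.castRingHom ℚ)).conductorNorm ℤ) ((⟨0, -1, 1, -24, 54⟩ : WeierstrassCurve ℤ).map (Int.castRingHom ℚ)) K 7 ℓ ∧
        d.kolyvaginClass (p := 7) (by norm_num) 1 ≠ 0)) :
    haveI := minTwist23_isElliptic; haveI := minTwist23_isGloballyMinimal;
    haveI : NeZero (((⟨0, -1, 1, -12872, -557532⟩ : WeierstrassCurve ℤ).map (Int.castRingHom ℚ)).conductorNorm ℤ) := neZero_conductorNorm_of_isElliptic _;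
    haveI := Fact.mk (by norm_num : Nat.Prime 7);
    ∀ (D : ModularParametrizationData ((⟨0, -1, 1, -12872, -557532⟩ : WeierstrassCurve ℤ).map (Int.castRingHom ℚ)) (((⟨0, -1, 1, -12872, -557532⟩ : WeierstrassCurve ℤ).map (Int.castRingHom ℚ)).conductorNorm ℤ)),
      ¬ ((7 : ℕ) : ℤ) ∣ D.maninConstant →
      (∃ u : ℚ, ‖(u : ℚ_[7])‖ = 1 ∧ ((⟨0, -1, 1, -12872, -557532⟩ : WeierstrassCurve ℤ).map (Int.castRingHom ℚ)).realPeriodRat = u * plusPeriod D.f) →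
      ∃ ψ : (q : ℕ) → (ZMod q)ˣ →* Multiplicative (ZMod 7),
        (∀ q ∈ (239 : ℕ).primeFactors, Function.Surjective (ψ q)) ∧ kuriharaNumber D.f 7 239 ψ ≠ 0 := by
  haveI := isElliptic_c997c1
  haveI := isGloballyMinimal_c997c1
  haveI iNZ : NeZero (((⟨0, -1, 1, -24, 54⟩ : WeierstrassCurve ℤ).map (Int.castRingHom ℚ)).conductorNorm ℤ) := neZero_conductorNorm_of_isElliptic _
  haveI iP := Fact.mk (by norm_num : Nat.Prime 7)
  exact twistKuriharaClaim_239_of_natCard_selmerGroup_le hSak3 K hD ((exactRowZhang_7_neg23 h372 h84 K hK hD).mp hbit).2.2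

/-- **ROW `997c1` @ `(7, -23)`: a unit at `239` CLOSES the crux at `997c1`.** For every imaginary quadratic `K` with `d_K = -23`,
granted Kim Thm. 1.11, modularity, Mazur Cor. 4.1, W. Zhang L8.4 (1)/9.1 BY NAME and the E-side record claim `hδE`
(`cert_997c1` @ `(7, 10277)`): IF every admissible datum of `T₀` has a unit mod-`7` Kurihara number AT `239` (the claim of a future
record `cert_<T₀>` @ `(7, 239)`), THEN the clause of `KolyvaginDepthSupplyKN` holds at `W = 997c1` VERBATIM (the socket
`cruxBody_of_twistKuriharaClaim_7_neg23` at the prime level `m = 239`, `ν = 1 ≤ 2`). Together with `twistKuriharaClaim_239_of_bit`: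
the fleet's ONE residue `δ̃_239(T₀) mod 7` decides the crux at `997c1` modulo print. CONDITIONAL on the named facts and the claims;
per curve; BSD is not proved by it. [cite: Kim2022StructureSelmer, Thm. 1.11 (PDF p. 8)] [cite: WZhang2014, Lemma 8.4 (1) (p. 236), Thm. 9.1 (p. 240)]
[cite: Mazur1978, Cor. 4.1] [cite: CremonaAlgorithms1997, Table 1 (997c1)] -/
theorem cruxBody_of_unit_239
    (hKim : Kim2022_card_selmerGroup_le_pow_of_kuriharaNumber_ne_zero)
    (hnf : exists_isNewformOf) (hMaz : mazur_not_dvd_maninConstant_of_odd)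
    (h84 : Literature.NumberTheory.EllipticCurves.WZhang2014_lemma84_exists_minimal_kolyvaginClass_one_selmerCard)
    (K : Type) [Field K] [NumberField K] (hK : IsImaginaryQuadratic K) (hD : NumberField.discr K = -23)
    (hδE : haveI := isElliptic_c997c1; haveI := isGloballyMinimal_c997c1;
      haveI : NeZero (((⟨0, -1, 1, -24, 54⟩ : WeierstrassCurve ℤ).map (Int.castRingHom ℚ)).conductorNorm ℤ) := neZero_conductorNorm_of_isElliptic _;
      haveI := Fact.mk (by norm_num : Nat.Prime 7);
      ∀ (D : ModularParametrizationData ((⟨0, -1, 1, -24, 54⟩ : WeierstrassCurve ℤ).map (Int.castRingHom ℚ)) (((⟨0, -1, 1, -24, 54⟩ : WeierstrassCurve ℤ).map (Int.castRingHom ℚ)).conductorNorm ℤ)), ¬ ((7 : ℕ) : ℤ) ∣ D.maninConstant →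
        (∃ u : ℚ, ‖(u : ℚ_[7])‖ = 1 ∧ ((⟨0, -1, 1, -24, 54⟩ : WeierstrassCurve ℤ).map (Int.castRingHom ℚ)).realPeriodRat = u * plusPeriod D.f) →
        ∃ ψ : (ℓ : ℕ) → (ZMod ℓ)ˣ →* Multiplicative (ZMod 7),
          (∀ ℓ ∈ (10277 : ℕ).primeFactors, Function.Surjective (ψ ℓ)) ∧ kuriharaNumber D.f 7 10277 ψ ≠ 0)
    (hunit : haveI := minTwist23_isElliptic; haveI := minTwist23_isGloballyMinimal;
    haveI : NeZero (((⟨0, -1, 1, -12872, -557532⟩ : WeierstrassCurve ℤ).map (Int.castRingHom ℚ)).conductorNorm ℤ) := neZero_conductorNorm_of_isElliptic _;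
    haveI := Fact.mk (by norm_num : Nat.Prime 7);
      ∀ (D : ModularParametrizationData ((⟨0, -1, 1, -12872, -557532⟩ : WeierstrassCurve ℤ).map (Int.castRingHom ℚ)) (((⟨0, -1, 1, -12872, -557532⟩ : WeierstrassCurve ℤ).map (Int.castRingHom ℚ)).conductorNorm ℤ)),
      ¬ ((7 : ℕ) : ℤ) ∣ D.maninConstant →
      (∃ u : ℚ, ‖(u : ℚ_[7])‖ = 1 ∧ ((⟨0, -1, 1, -12872, -557532⟩ : WeierstrassCurve ℤ).map (Int.castRingHom ℚ)).realPeriodRat = u * plusPeriod D.f) →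
      ∃ ψ : (q : ℕ) → (ZMod q)ˣ →* Multiplicative (ZMod 7),
        (∀ q ∈ (239 : ℕ).primeFactors, Function.Surjective (ψ q)) ∧ kuriharaNumber D.f 7 239 ψ ≠ 0) :
    haveI := isElliptic_c997c1; haveI := isGloballyMinimal_c997c1;
    ∃ (p : ℕ) (hp : Fact p.Prime), 5 ≤ p ∧ ((⟨0, -1, 1, -24, 54⟩ : WeierstrassCurve ℤ).map (Int.castRingHom ℚ)).HasGoodReductionAtPrime p ∧
      ¬ (p : ℤ) ∣ ((⟨0, -1, 1, -24, 54⟩ : WeierstrassCurve ℤ).map (Int.castRingHom ℚ)).frobeniusTrace p ∧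
      (∀ n : ℕ, ((⟨0, -1, 1, -24, 54⟩ : WeierstrassCurve ℤ).map (Int.castRingHom ℚ)).HasSurjectiveModNGaloisRep (p ^ n : ℕ)) ∧
      (∀ v : HeightOneSpectrum (𝓞 ℚ), ((⟨0, -1, 1, -24, 54⟩ : WeierstrassCurve ℤ).map (Int.castRingHom ℚ)).HasMultiplicativeReductionAt v →
        ¬ p ∣ ((⟨0, -1, 1, -24, 54⟩ : WeierstrassCurve ℤ).map (Int.castRingHom ℚ)).ordMinimalDiscriminant v) ∧
      ∃ (K : Type) (_ : Field K) (_ : NumberField K), IsImaginaryQuadratic K ∧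
        NumberField.discr K ≠ -3 ∧ NumberField.discr K ≠ -4 ∧
        ∃ (_ : NeZero (((⟨0, -1, 1, -24, 54⟩ : WeierstrassCurve ℤ).map (Int.castRingHom ℚ)).conductorNorm ℤ)),
          SatisfiesHeegnerHypothesis (((⟨0, -1, 1, -24, 54⟩ : WeierstrassCurve ℤ).map (Int.castRingHom ℚ)).conductorNorm ℤ) K ∧
        ∃ (Dt : ModularParametrizationData ((⟨0, -1, 1, -24, 54⟩ : WeierstrassCurve ℤ).map (Int.castRingHom ℚ)) (((⟨0, -1, 1, -24, 54⟩ : WeierstrassCurve ℤ).map (Int.castRingHom ℚ)).conductorNorm ℤ))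
          (β : ℤ) (ι : K →+* ℂ) (n₁ : ℕ) (d : KolyvaginHeegnerData Dt β ι n₁), Squarefree n₁ ∧
          (∀ q ∈ n₁.primeFactors, Zhang2014.IsKolyvaginPrime (((⟨0, -1, 1, -24, 54⟩ : WeierstrassCurve ℤ).map (Int.castRingHom ℚ)).conductorNorm ℤ)
            ((⟨0, -1, 1, -24, 54⟩ : WeierstrassCurve ℤ).map (Int.castRingHom ℚ)) K p q) ∧
          d.kolyvaginClass hp.out 1 ≠ 0 ∧
          (n₁.primeFactors.card + 1 ≤ ((⟨0, -1, 1, -24, 54⟩ : WeierstrassCurve ℤ).map (Int.castRingHom ℚ)).mordellWeilRank ∨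
            (n₁.primeFactors.card ≤ ((⟨0, -1, 1, -24, 54⟩ : WeierstrassCurve ℤ).map (Int.castRingHom ℚ)).mordellWeilRank ∧
              n₁.primeFactors.card + 1 ≤ (((⟨0, -1, 1, -24, 54⟩ : WeierstrassCurve ℤ).map (Int.castRingHom ℚ)).quadraticTwist
                (NumberField.discr K : ℚ)).mordellWeilRank)) := by
  haveI := minTwist23_isElliptic
  haveI := minTwist23_isGloballyMinimal
  haveI : Fact (Nat.Prime 239) := ⟨by norm_num⟩
  haveI : NeZero (239 : ℕ) := ⟨by norm_num⟩
  exact cruxBody_of_twistKuriharaClaim_7_neg23 hKim hnf hMaz h84 K hK hD hδE 239 minTwist23_isCyclicKolyvaginLevel_7_239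
    (by rw [Nat.Prime.primeFactors (by norm_num), Finset.card_singleton]; norm_num) hunit

end C997c1

end Summit.BirchSwinnertonDyer.BirchSwinnertonDyer.Theorems.KolyvaginDepthDoor

end
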